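import Mathlib
import Summits.ValiantsHypothesis.ValiantsHypothesis.Theorems.FifoMatchingNNNotVPSupportFnHardOfCore
import Literature.Computability.Complexity.FormulaComposition
import Literature.Computability.AlgebraicComplexity.ArithCircuitProofs
import HarnessLib

/-!
# Route FifoMatching — crux `NNNotVP` (stmt-ValiantsHypothesis-11615), line `division_split`:
# stub A is a monotone BOOLEAN circuit lower bound (the Boolean shadow of a monotone circuit)

Registered line `Cruxes/NNNotVP/Lines/division_split.lean`; objects `σ` / `NN` / `SuppFn` /
`freeVars` = the line's vocabulary (`Theorems/FifoMatchingNNNotVPDivisionSplitDefs.lean`).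

The companions reduce stub A (`stub_supportFnHard`) to its free-arc-free CORE: every nonnegative
polynomial with the support function of `NN_n` has super-quasi-polynomial monotone arithmetic
complexity `L₊`.  This file places the core in the tree's BOOLEAN circuit vocabulary
(`Literature.Computability.Complexity.Circuit`, straight-line programs; `monotoneBasis = {∧₂, ∨₂}`):

* `exists_monotoneCircuit_eval_ne_zero` — **the Boolean shadow**: for every `g ∈ ℝ≥0[x_τ]` there
  is a circuit over `monotoneBasis ∪ {1, 0}` (fan-in-two AND/OR plus the two constant gates) with
  at most `L₊(g) + 2` gates computing `x ↦ [g(1_x) ≠ 0]` — i.e. (`suppFn_iff_eval_ne_zero`) the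
  support function of `g`.  Proof: take a minimal fan-in-two arithmetic circuit for `g`
  (`ArithCircuit.exists_computes_size_eq_complexity`) and replace, gate by gate, `+`/positive
  scalars by `∨`, `×` by `∧`, constants `c` by `[c ≠ 0]`; over `ℝ≥0` a sum (product) of values is
  nonzero iff some summand is (all factors are), so every wire carries `[value(1_x) ≠ 0]`.
* `core_of_monotoneBooleanLowerBound` — hence a super-quasi-polynomial lower bound for monotone
  Boolean circuits (with constants) computing nest-free perfect-matching EXISTENCE on ordered graphs
  («does the arc set `x ⊆ [2n]²` contain a nest-free perfect matching of `[2n]`» = shuffle-square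
  recognition, NP-complete by Buss–Soltys 2014) implies the core, hence (`supportFnHard_of_core`)
  stub A verbatim: `supportFnHard_of_monotoneBooleanLowerBound`.

Honest framing: a reduction; the Boolean lower bound is OPEN (no monotone lower bound for
shuffle-square recognition is in print; the tree's approximation-method files treat CLIQUE and
bipartite perfect matching), so are stubs Z / A / B2, the crux `NNNotVP` and `VP ≠ VNP`
(NOT proved).  No definitions, no named facts.
-/

noncomputable section

-- Sub = Summit single-conjunct layout: the duplicated namespace component is mandated by the tree.
set_option linter.dupNamespace false

namespace Summit.ValiantsHypothesis.ValiantsHypothesis.Theorems.FifoMatching.NNNotVP.DivisionSplit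

open MvPolynomial Literature.Computability.AlgebraicComplexity
open Literature.Computability.Complexity
open Literature.Computability.Complexity.GateList
open scoped NNReal BigOperators Classical

variable {τ : Type*}

/-! ### Boolean bookkeeping -/

/-- Composing a function with a pair of wires. [folklore] -/
theorem comp_vecCons_two {α β : Type*} (f : α → β) (a b : α) :
    (fun t : Fin 2 => f ((![a, b] : Fin 2 → α) t)) = ![f a, f b] := by
  funext t
  fin_cases t <;> rfl

/-- Over `ℝ≥0`: a sum is nonzero iff a summand is. [folklore] -/
theorem decide_add_ne_zero (a b : ℝ≥0) :
    decide (a + b ≠ 0) = (decide (a ≠ 0) || decide (b ≠ 0)) := by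
  have h : a + b ≠ 0 ↔ a ≠ 0 ∨ b ≠ 0 := by rw [Ne, add_eq_zero]; tauto
  rw [Bool.eq_iff_iff]; simp only [Bool.or_eq_true, decide_eq_true_eq]; exact h

/-- Over `ℝ≥0`: a product is nonzero iff both factors are. [folklore] -/
theorem decide_mul_ne_zero (a b : ℝ≥0) :
    decide (a * b ≠ 0) = (decide (a ≠ 0) && decide (b ≠ 0)) := by
  rw [Bool.eq_iff_iff]; simp only [Bool.and_eq_true, decide_eq_true_eq]; exact mul_ne_zero_iff

/-! ### The Boolean shadow of a monotone arithmetic circuit -/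

/-- **The Boolean shadow of a monotone arithmetic circuit.**  For every `g ∈ ℝ≥0[x_τ]` there is
a straight-line circuit over `monotoneBasis ∪ {1, 0}` with at most `L₊(g) + 2` gates computing
`x ↦ [g(1_x) ≠ 0]`, the support function of `g` (`suppFn_iff_eval_ne_zero`). [folklore] -/
theorem exists_monotoneCircuit_eval_ne_zero (g : MvPolynomial τ ℝ≥0) :
    ∃ C : Circuit τ, C.IsOver (monotoneBasis ∪ {GateFn.const true, GateFn.const false}) ∧
      C.size ≤ complexity g + 2 ∧
      ∀ x : τ → Bool, C.eval x = decide (eval (fun v => if x v then (1 : ℝ≥0) else 0) g ≠ 0) := by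
  -- a minimal fan-in-two (monotone: all constants are in `ℝ≥0`) arithmetic circuit for `g`
  obtain ⟨P, hP2, hPg, hPs⟩ := ArithCircuit.exists_computes_size_eq_complexity g
  -- the Boolean shadow of a polynomial at the 0/1 point of `x`
  let b : (τ → Bool) → MvPolynomial τ ℝ≥0 → Bool :=
    fun x p => decide (eval (fun v => if x v then (1 : ℝ≥0) else 0) p ≠ 0)
  -- wires: gate `j` of the arithmetic circuit becomes gate `j + 2` (gates `0`, `1` are the
  -- constants `0`, `1`); a junk forward reference (value `0`) becomes the constant `0`
  let wop : ℕ → ArithCircuit.Operand ℝ≥0 τ → τ ⊕ ℕ := fun i u =>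
    match u with
    | .var v => .inl v
    | .const c => if c = 0 then .inr 0 else .inr 1
    | .gate j => if j < i then .inr (j + 2) else .inr 0
  let wco : ℕ → ℝ≥0 × ArithCircuit.Operand ℝ≥0 τ → τ ⊕ ℕ := fun i a =>
    if a.1 = 0 then .inr 0 else wop i a.2
  let orG : (τ ⊕ ℕ) → (τ ⊕ ℕ) → Gate τ := fun w₁ w₂ => ⟨2, (GateFn.or 2).2, ![w₁, w₂]⟩
  let andG : (τ ⊕ ℕ) → (τ ⊕ ℕ) → Gate τ := fun w₁ w₂ => ⟨2, (GateFn.and 2).2, ![w₁, w₂]⟩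
  let cF : Gate τ := ⟨0, fun _ => false, Fin.elim0⟩
  let cT : Gate τ := ⟨0, fun _ => true, Fin.elim0⟩
  let tg : ℕ → ArithCircuit.Gate ℝ≥0 τ → Gate τ := fun i G =>
    match G with
    | .sum [] => cF
    | .sum [a] => orG (wco i a) (wco i a)
    | .sum (a :: a' :: _) => orG (wco i a) (wco i a')
    | .prod [] => cT
    | .prod [u] => andG (wop i u) (wop i u)
    | .prod (u :: u' :: _) => andG (wop i u) (wop i u')
  -- membership in the basis
  have hcF : cF.fn ∈ monotoneBasis ∪ {GateFn.const true, GateFn.const false} :=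
    Or.inr (by simp [Gate.fn, cF, GateFn.const])
  have hcT : cT.fn ∈ monotoneBasis ∪ {GateFn.const true, GateFn.const false} :=
    Or.inr (by simp [Gate.fn, cT, GateFn.const])
  have horG : ∀ w₁ w₂, (orG w₁ w₂).fn ∈ monotoneBasis ∪ {GateFn.const true, GateFn.const false} :=
    fun w₁ w₂ => Or.inl (by simp [Gate.fn, orG, monotoneBasis, GateFn.or])
  have handG : ∀ w₁ w₂, (andG w₁ w₂).fn ∈ monotoneBasis ∪ {GateFn.const true, GateFn.const false} :=
    fun w₁ w₂ => Or.inl (by simp [Gate.fn, andG, monotoneBasis, GateFn.and])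
  have htgB : ∀ i G, (tg i G).fn ∈ monotoneBasis ∪ {GateFn.const true, GateFn.const false} := by
    intro i G
    rcases G with args | args
    · rcases args with _ | ⟨a, _ | ⟨a', rest⟩⟩
      · exact hcF
      · exact horG _ _
      · exact horG _ _
    · rcases args with _ | ⟨u, _ | ⟨u', rest⟩⟩
      · exact hcT
      · exact handG _ _
      · exact handG _ _
  -- wires only look back
  have hwopOK : ∀ i u m, wop i u = .inr m → m < i + 2 := by
    intro i u m h
    rcases u with v | c | j
    · simp [wop] at h
    · by_cases hc : c = 0
      · simp [wop, hc] at h; omega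
      · simp [wop, hc] at h; omega
    · by_cases hj : j < i
      · simp [wop, hj] at h; omega
      · simp [wop, hj] at h; omega
  have hwcoOK : ∀ i a m, wco i a = .inr m → m < i + 2 := by
    intro i a m h
    by_cases ha : a.1 = 0
    · simp [wco, ha] at h; omega
    · simp only [wco, ha, if_false] at h
      exact hwopOK i a.2 m h
  have hpairOK : ∀ (i : ℕ) (op : (Fin 2 → Bool) → Bool) (w₁ w₂ : τ ⊕ ℕ),
      (∀ m, w₁ = .inr m → m < i + 2) → (∀ m, w₂ = .inr m → m < i + 2) →
        GateOK (i + 2) (⟨2, op, ![w₁, w₂]⟩ : Gate τ) := by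
    intro i op w₁ w₂ h₁ h₂ a m ha
    fin_cases a
    · exact h₁ m (by simpa using ha)
    · exact h₂ m (by simpa using ha)
  have htgOK : ∀ i G, GateOK (i + 2) (tg i G) := by
    intro i G
    rcases G with args | args
    · rcases args with _ | ⟨a, _ | ⟨a', rest⟩⟩
      · exact fun a => a.elim0
      · exact hpairOK i _ _ _ (hwcoOK i a) (hwcoOK i a)
      · exact hpairOK i _ _ _ (hwcoOK i a) (hwcoOK i a')
    · rcases args with _ | ⟨u, _ | ⟨u', rest⟩⟩
      · exact fun a => a.elim0
      · exact hpairOK i _ _ _ (hwopOK i u) (hwopOK i u)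
      · exact hpairOK i _ _ _ (hwopOK i u) (hwopOK i u')
  -- semantics of wires
  have hb0 : ∀ x, b x 0 = false := fun x => by simp [b]
  have hwop : ∀ (x : τ → Bool) (vs : List (MvPolynomial τ ℝ≥0)) (i : ℕ), vs.length = i →
      ∀ u : ArithCircuit.Operand ℝ≥0 τ,
        wireOf x ([false, true] ++ vs.map (b x)) (wop i u) = b x (u.eval vs) := by
    intro x vs i hi u
    rcases u with v | c | j
    · simp only [wop, wireOf_inl, ArithCircuit.Operand.eval, b, eval_X]
      cases x v <;> simp
    · by_cases hc : c = 0
      · simp [wop, hc, b, ArithCircuit.Operand.eval]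
      · simp [wop, hc, b, ArithCircuit.Operand.eval]
    · by_cases hj : j < i
      · simp only [wop, hj, if_true, wireOf_inr, ArithCircuit.Operand.eval_gate]
        rw [List.getD_eq_getElem?_getD, List.getElem?_append_right (by simp),
          ← List.getD_eq_getElem?_getD]
        simp only [List.length_cons, List.length_nil]
        rw [show j + 2 - (0 + 1 + 1) = j by omega, ← hb0 x, List.getD_map]
      · simp only [wop, hj, if_false, wireOf_inr, ArithCircuit.Operand.eval_gate]
        rw [List.getD_eq_default _ _ (show vs.length ≤ j by omega), hb0 x]
        simp
  have hwco : ∀ (x : τ → Bool) (vs : List (MvPolynomial τ ℝ≥0)) (i : ℕ), vs.length = i →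
      ∀ a : ℝ≥0 × ArithCircuit.Operand ℝ≥0 τ,
        wireOf x ([false, true] ++ vs.map (b x)) (wco i a) = b x (a.1 • a.2.eval vs) := by
    intro x vs i hi a
    by_cases ha : a.1 = 0
    · simp [wco, ha, hb0]
    · simp only [wco, ha, if_false]
      rw [hwop x vs i hi a.2]
      simp only [b, smul_eval, decide_mul_ne_zero]
      simp [ha]
  -- semantics of gates
  have htg : ∀ (x : τ → Bool) (vs : List (MvPolynomial τ ℝ≥0)) (i : ℕ), vs.length = i →
      ∀ G : ArithCircuit.Gate ℝ≥0 τ, G.fanIn ≤ 2 →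
        (tg i G).op (fun a => wireOf x ([false, true] ++ vs.map (b x)) ((tg i G).args a)) =
          b x (G.eval vs) := by
    intro x vs i hi G hG
    rcases G with args | args
    · rcases args with _ | ⟨a, _ | ⟨a', _ | ⟨a'', rest⟩⟩⟩
      · simp [tg, cF, hb0, ArithCircuit.Gate.eval]
      · simp only [tg, orG]
        rw [comp_vecCons_two, Circuit.or_two_apply_pair, hwco x vs i hi a]
        simp [ArithCircuit.Gate.eval, Bool.or_self]
      · simp only [tg, orG]
        rw [comp_vecCons_two, Circuit.or_two_apply_pair, hwco x vs i hi a, hwco x vs i hi a']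
        simp only [ArithCircuit.Gate.eval, List.map_cons, List.map_nil, List.sum_cons,
          List.sum_nil, add_zero, b, map_add, decide_add_ne_zero]
      · exfalso
        simp [ArithCircuit.Gate.fanIn, ArithCircuit.Gate.args] at hG
    · rcases args with _ | ⟨u, _ | ⟨u', _ | ⟨u'', rest⟩⟩⟩
      · simp [tg, cT, b, ArithCircuit.Gate.eval]
      · simp only [tg, andG]
        rw [comp_vecCons_two, Circuit.and_two_apply_pair, hwop x vs i hi u]
        simp [ArithCircuit.Gate.eval, Bool.and_self]
      · simp only [tg, andG]
        rw [comp_vecCons_two, Circuit.and_two_apply_pair, hwop x vs i hi u, hwop x vs i hi u']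
        simp only [ArithCircuit.Gate.eval, List.map_cons, List.map_nil, List.prod_cons,
          List.prod_nil, mul_one, b, map_mul, decide_mul_ne_zero]
      · exfalso
        simp [ArithCircuit.Gate.fanIn, ArithCircuit.Gate.args] at hG
  -- the translated program, by induction along the arithmetic circuit
  have key : ∀ gs : List (ArithCircuit.Gate ℝ≥0 τ), (∀ G ∈ gs, G.fanIn ≤ 2) →
      ∃ bs : List (Gate τ), bs.length = gs.length + 2 ∧ WF bs ∧
        (∀ G ∈ bs, G.fn ∈ monotoneBasis ∪ {GateFn.const true, GateFn.const false}) ∧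
        ∀ x, vals bs x = [false, true] ++ (ArithCircuit.gateValues gs).map (b x) := by
    intro gs
    induction gs using List.reverseRecOn with
    | nil =>
      intro _
      refine ⟨[cF, cT], rfl, ?_, ?_, fun x => ?_⟩
      · have h1 : WF [cF] := WF.singleton fun a => a.elim0
        have h2 : WF ([cF] ++ [cT]) := h1.append_singleton fun a => a.elim0
        simpa using h2
      · intro G hG
        simp only [List.mem_cons, List.mem_nil_iff, or_false] at hG
        rcases hG with rfl | rfl
        · exact hcF
        · exact hcT
      · simp [vals, cF, cT, ArithCircuit.gateValues]
    | append_singleton gs G ih =>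
      intro hfan
      obtain ⟨bs, hlen, hwf, hover, hvals⟩ :=
        ih fun G' hG' => hfan G' (List.mem_append_left _ hG')
      have hG : G.fanIn ≤ 2 := hfan G (List.mem_append_right _ (List.mem_singleton_self G))
      refine ⟨bs ++ [tg gs.length G], by simp [hlen], ?_, ?_, fun x => ?_⟩
      · exact hwf.append_singleton (hlen ▸ htgOK gs.length G)
      · intro G' hG'
        rcases List.mem_append.1 hG' with h | h
        · exact hover G' h
        · rw [List.mem_singleton] at h
          subst h
          exact htgB _ _
      · rw [vals_append_singleton, hvals, ArithCircuit.gateValues_append_singleton,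
          List.map_append, List.map_singleton, List.append_assoc]
        rw [htg x _ gs.length (ArithCircuit.gateValues_length gs) G hG]
  -- assemble the circuit
  obtain ⟨bs, hlen, hwf, hover, hvals⟩ := key P.gates hP2
  have hout : ∀ m, wop P.gates.length P.output = .inr m → m < bs.length := by
    intro m hm
    rw [hlen]
    exact hwopOK _ _ m hm
  have hreal : CktSize (monotoneBasis ∪ {GateFn.const true, GateFn.const false})
      (fun (x : τ → Bool) (_ : Unit) => b x g) (complexity g + 2) := by
    refine ⟨bs, fun _ => wop P.gates.length P.output, ?_, ⟨hwf, hover, fun _ m hm => hout m hm,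
      fun x _ => ?_⟩⟩
    · rw [hlen, ← hPs]; rfl
    · rw [hvals, hwop x _ P.gates.length (ArithCircuit.gateValues_length P.gates) P.output]
      show b x P.eval = b x g
      rw [show P.eval = g from hPg]
  obtain ⟨C, hC1, hC2, hC3⟩ := hreal.toCircuit
  exact ⟨C, hC1, hC2, fun x => hC3 x⟩

/-- The Boolean shadow in the line's vocabulary: a circuit over `monotoneBasis ∪ {1, 0}` with at
most `L₊(g) + 2` gates computes the support function `A ↦ SuppFn g A` (as a function of the
indicator vector of `A`). [folklore] -/
theorem exists_monotoneCircuit_suppFn [Fintype τ] (g : MvPolynomial τ ℝ≥0) :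
    ∃ C : Circuit τ, C.IsOver (monotoneBasis ∪ {GateFn.const true, GateFn.const false}) ∧
      C.size ≤ complexity g + 2 ∧
      ∀ x : τ → Bool, C.eval x = decide (SuppFn g (Finset.univ.filter fun v => x v = true)) := by
  obtain ⟨C, hC1, hC2, hC3⟩ := exists_monotoneCircuit_eval_ne_zero g
  refine ⟨C, hC1, hC2, fun x => ?_⟩
  rw [hC3 x]
  apply decide_eq_decide.2  -- both sides are decisions of equivalent propositions
  rw [suppFn_iff_eval_ne_zero]
  have h : (fun v => if v ∈ (Finset.univ.filter fun v => x v = true) then (1 : ℝ≥0) else 0) =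
      fun v => if x v then (1 : ℝ≥0) else 0 := by
    funext v
    simp
  rw [h]

/-! ### The core of stub A is a monotone Boolean circuit lower bound -/

/-- **A monotone Boolean lower bound implies the core of stub A.**  If, for every `c`, eventually
every circuit over `monotoneBasis ∪ {1, 0}` computing nest-free perfect-matching EXISTENCE on the
ordered arc sets of `[2n]` (the support function of `NN_n`) has more than `2^((log₂ n + c)^c)`
gates, then every nonnegative polynomial with the support function of `NN_n` has
`L₊ > 2^((log₂ n + c)^c)` eventually (its Boolean shadow is such a circuit, two gates larger).
[folklore] -/
theorem core_of_monotoneBooleanLowerBound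
    (hB : ∀ c : ℕ, ∃ n₀ : ℕ, ∀ n ≥ n₀, ∀ C : Circuit (σ n),
      C.IsOver (monotoneBasis ∪ {GateFn.const true, GateFn.const false}) →
      (∀ x : σ n → Bool, C.eval x = decide (SuppFn (NN n) (Finset.univ.filter fun e => x e = true))) →
        2 ^ ((Nat.log 2 n + c) ^ c) < C.size) :
    ∀ c : ℕ, ∃ n₀ : ℕ, ∀ n ≥ n₀, ∀ g : MvPolynomial (σ n) ℝ≥0,
      (∀ A : Finset (σ n), SuppFn g A ↔ SuppFn (NN n) A) →
        2 ^ ((Nat.log 2 n + c) ^ c) < complexity g := by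
  intro c
  obtain ⟨n₀, hn₀⟩ := hB (c + 1)
  refine ⟨max n₀ 2, fun n hn g hg => ?_⟩
  have hn0 : n₀ ≤ n := le_trans (le_max_left _ _) hn
  have hn2 : 2 ≤ n := le_trans (le_max_right _ _) hn
  obtain ⟨C, hC1, hC2, hC3⟩ := exists_monotoneCircuit_suppFn g
  have hC3' : ∀ x : σ n → Bool,
      C.eval x = decide (SuppFn (NN n) (Finset.univ.filter fun e => x e = true)) := by
    intro x
    rw [hC3 x]
    exact decide_eq_decide.2 (hg _)
  have hlt := hn₀ n hn0 C hC1 hC3'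
  -- `2^((L+c)^c) + 2 ≤ 2^((L+c+1)^(c+1))` once `L = ⌊log₂ n⌋ ≥ 1`
  have hL : 1 ≤ Nat.log 2 n := Nat.le_log_of_pow_le (by norm_num) (by simpa using hn2)
  have h1 : 1 ≤ (Nat.log 2 n + c) ^ c := Nat.one_le_pow _ _ (by omega)
  have h2 : (Nat.log 2 n + c) ^ c + 1 ≤ (Nat.log 2 n + (c + 1)) ^ (c + 1) := by
    calc (Nat.log 2 n + c) ^ c + 1 ≤ (Nat.log 2 n + c) ^ c * 2 := by omega
      _ ≤ (Nat.log 2 n + (c + 1)) ^ c * (Nat.log 2 n + (c + 1)) :=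
          Nat.mul_le_mul (Nat.pow_le_pow_left (by omega) c) (by omega)
      _ = (Nat.log 2 n + (c + 1)) ^ (c + 1) := by ring
  have h3 : 2 ^ ((Nat.log 2 n + c) ^ c) + 2 ≤ 2 ^ ((Nat.log 2 n + (c + 1)) ^ (c + 1)) := by
    calc 2 ^ ((Nat.log 2 n + c) ^ c) + 2 ≤ 2 ^ ((Nat.log 2 n + c) ^ c) * 2 := by
          have : 2 ≤ 2 ^ ((Nat.log 2 n + c) ^ c) := by
            calc 2 = 2 ^ 1 := by norm_num
              _ ≤ 2 ^ ((Nat.log 2 n + c) ^ c) := Nat.pow_le_pow_right (by norm_num) h1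
          omega
      _ = 2 ^ ((Nat.log 2 n + c) ^ c + 1) := by ring
      _ ≤ 2 ^ ((Nat.log 2 n + (c + 1)) ^ (c + 1)) := Nat.pow_le_pow_right (by norm_num) h2
  omega

/-- **A monotone Boolean lower bound implies stub A (`stub_supportFnHard`) verbatim**
(`core_of_monotoneBooleanLowerBound` ∘ `supportFnHard_of_core`). [folklore] -/
theorem supportFnHard_of_monotoneBooleanLowerBound
    (hB : ∀ c : ℕ, ∃ n₀ : ℕ, ∀ n ≥ n₀, ∀ C : Circuit (σ n),
      C.IsOver (monotoneBasis ∪ {GateFn.const true, GateFn.const false}) →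
      (∀ x : σ n → Bool, C.eval x = decide (SuppFn (NN n) (Finset.univ.filter fun e => x e = true))) →
        2 ^ ((Nat.log 2 n + c) ^ c) < C.size) :
    ∀ k c : ℕ, ∃ n₀ : ℕ, ∀ n ≥ n₀, ∀ T : Finset (σ n), T.card ≤ (Nat.log 2 n + k) ^ k →
      ∀ g : MvPolynomial (σ n) ℝ≥0, (∀ A : Finset (σ n), SuppFn g A ↔ SuppFn (freeVars T (NN n)) A) →
        2 ^ ((Nat.log 2 n + c) ^ c) < complexity g :=
  supportFnHard_of_core (core_of_monotoneBooleanLowerBound hB)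

end Summit.ValiantsHypothesis.ValiantsHypothesis.Theorems.FifoMatching.NNNotVP.DivisionSplit

end
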